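import Mathlib

/-!
# Solo-blind seat, s15 anchor 3: hyperplane subgroup pairs are saturated (Theorem 9) — kernel pieces

Companion to `paper/LieExponent.md` §3.22 (solo-blind seat `solo-MatrixMultiplication-blind`, s15).

THEOREM 9 there: in a real Lie group, a TPP triple two of whose members are connected Lie subgroups
`H₂, H₃` spanning a hyperplane `ker μ` has its third member pinned to `α_μ = 0` for free, and the
Cauchy-characteristic slices of the three members form a TPP triple inside the characteristic group `A`
in which the two subgroup slices already fill `dim A`; so the third slice is finite and
`dim M₁ ≤ ρ_μ/2`.  Over a Borel-type pair `(T_A N⁺, T_B N⁻)` of `GL_n(ℝ)` the group `A = T_c` is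
abelian and the conclusion is `dim M₁ ≤ n(n−1)/2`: Theorem 1's count `3N + n − 1` is optimal over its
own pair, for every `n`.

Kernel-checked here:
* `soloLie_abelian_tpp_mul_injOn` — in a commutative group the TPP (quotient form) makes the triple
  multiplication map injective on `S₁ × S₂ × S₃` (the abelian packing step used inside `A = T_c`);
  `soloLie_abelian_tpp_card_le` — its finite shadow `|S₁||S₂||S₃| ≤ |A|`.
* `soloLie_thm9_borelPair_dim_le` — the dimension bookkeeping of Theorem 9(iv):
  slice `≥ d₁ − N`, slices of the pair `= dim 𝔱_A + dim 𝔱_B = n − 1 = dim T_c`, abelian packing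
  `⟹ d₁ ≤ N`.
* `soloLie_thm9_count_below_threshold` — Theorem 9(iii): `2 d₁ ≤ ρ = d − 1 − a`, `a ≥ ind − 1`
  `⟹ 2Σ ≤ 3d − ind − 2`, strictly below the Kirillov threshold `2Σ > 3d − ind`.
* `soloLie_prop93_count` — the codimension-2 bookkeeping of Proposition 9.3 (`2Σ ≤ 3d − ind`).
* `soloLie_cor94_census`, `soloLie_cor94_slices` — the two finite checks behind Corollary 9.4 for
  `GL₇(ℝ)` (`d = 49`, `ind = 7`): two-subgroup templates of codimension ≥ 3 reach `Σ = 71` only in the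
  odd two-pair format `(25; 23, 23)`, and the `A`-slices in the one-subgroup case are forced to the
  two-pair format `(a/2 − 1, a/2, a/2 − 1)` of the even-dimensional characteristic group.
-/

set_option linter.dupNamespace false

namespace Summit.MatrixMultiplication.MatrixMultiplication.Theorems

/-- ABELIAN PACKING (LieExponent §3.22, Theorem 9(iv), the step inside `A = T_c`).  In a commutative
group, if `(S₁, S₂, S₃)` has the triple product property in quotient form — `a a'⁻¹ · b b'⁻¹ · c c'⁻¹ = 1`
with `a, a' ∈ S₁`, `b, b' ∈ S₂`, `c, c' ∈ S₃` forces `a = a'`, `b = b'`, `c = c'` — then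
`(a, b, c) ↦ a b c` is injective on `S₁ × S₂ × S₃`. -/
theorem soloLie_abelian_tpp_mul_injOn {A : Type*} [CommGroup A] (S₁ S₂ S₃ : Set A)
    (htpp : ∀ a ∈ S₁, ∀ a' ∈ S₁, ∀ b ∈ S₂, ∀ b' ∈ S₂, ∀ c ∈ S₃, ∀ c' ∈ S₃,
      a * a'⁻¹ * (b * b'⁻¹) * (c * c'⁻¹) = 1 → a = a' ∧ b = b' ∧ c = c') :
    Set.InjOn (fun p : A × A × A => p.1 * p.2.1 * p.2.2) (S₁ ×ˢ S₂ ×ˢ S₃) := by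
  rintro ⟨a, b, c⟩ ⟨ha, hb, hc⟩ ⟨a', b', c'⟩ ⟨ha', hb', hc'⟩ h
  dsimp only at h
  have key : a * a'⁻¹ * (b * b'⁻¹) * (c * c'⁻¹) = (a * b * c) * (a' * b' * c')⁻¹ := by
    simp only [mul_inv_rev]
    simp only [mul_assoc, mul_comm, mul_left_comm]
  have h1 : a * a'⁻¹ * (b * b'⁻¹) * (c * c'⁻¹) = 1 := by
    rw [key, h, mul_inv_cancel]
  obtain ⟨rfl, rfl, rfl⟩ := htpp a ha a' ha' b hb b' hb' c hc c' hc' h1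
  rfl

/-- Finite shadow of the abelian packing step: for finite sets with the triple product property in a
finite commutative group, `|S₁| · |S₂| · |S₃| ≤ |A|`. -/
theorem soloLie_abelian_tpp_card_le {A : Type*} [CommGroup A] [Fintype A] [DecidableEq A]
    (S₁ S₂ S₃ : Finset A)
    (htpp : ∀ a ∈ S₁, ∀ a' ∈ S₁, ∀ b ∈ S₂, ∀ b' ∈ S₂, ∀ c ∈ S₃, ∀ c' ∈ S₃,
      a * a'⁻¹ * (b * b'⁻¹) * (c * c'⁻¹) = 1 → a = a' ∧ b = b' ∧ c = c') :
    S₁.card * S₂.card * S₃.card ≤ Fintype.card A := by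
  have hinj : Set.InjOn (fun p : A × A × A => p.1 * p.2.1 * p.2.2)
      ((S₁ ×ˢ (S₂ ×ˢ S₃) : Finset (A × A × A)) : Set (A × A × A)) := by
    have := soloLie_abelian_tpp_mul_injOn (S₁ : Set A) (S₂ : Set A) (S₃ : Set A)
      (fun a ha a' ha' b hb b' hb' c hc c' hc' => htpp a ha a' ha' b hb b' hb' c hc c' hc')
    intro p hp q hq hpq
    apply this _ _ hpq
    · simpa [Set.mem_prod] using hp
    · simpa [Set.mem_prod] using hq
  have hle := Finset.card_le_card_of_injOn (fun p : A × A × A => p.1 * p.2.1 * p.2.2)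
    (s := S₁ ×ˢ (S₂ ×ˢ S₃)) (t := (Finset.univ : Finset A)) (fun _ _ => Finset.mem_univ _) hinj
  simpa [Finset.card_product, Finset.card_univ, mul_assoc] using hle

/-- THEOREM 9(iv) BOOKKEEPING (Borel-type pairs of `GL_n(ℝ)`).  With `N = n(n−1)/2`: the `T_c`-slice of
the third member has dimension `s ≥ d₁ − N` (isotropy modulo the radical `𝔱_c`), the slices of
`T_A N⁺`, `T_B N⁻` are `T_A`, `T_B` with `dim 𝔱_A + dim 𝔱_B = n − 1 = dim T_c`, and abelian packing in
`T_c` gives `s + dim 𝔱_A + dim 𝔱_B ≤ n − 1`; hence `d₁ ≤ N` and the triple has `Σ ≤ 3N + n − 1`,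
Theorem 1's count. -/
theorem soloLie_thm9_borelPair_dim_le (n d₁ s aA aB N : ℕ)
    (hsplit : aA + aB = n - 1) (hslice : d₁ ≤ N + s) (hpack : s + aA + aB ≤ n - 1) :
    d₁ ≤ N ∧ (aA + N) + (aB + N) + d₁ ≤ 3 * N + (n - 1) := by
  constructor <;> omega

/-- THEOREM 9(iii) COUNT.  For a hyperplane subgroup pair (`d₂ + d₃ = d − 1`) the third member has
`2 d₁ ≤ ρ = d − 1 − a` with `a ≥ ind 𝔤 − 1`; then `2Σ ≤ 3d − ind 𝔤 − 2`, strictly below the Kirillov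
threshold `2Σ > 3d − ind 𝔤` for certifying a Lie exponent `< 3`. -/
theorem soloLie_thm9_count_below_threshold (d ind a d₁ Sig : ℕ)
    (hρ : 2 * d₁ + a + 1 ≤ d) (hind : ind ≤ a + 1) (hSig : Sig = d - 1 + d₁) (hd : 1 ≤ d) :
    2 * Sig + ind + 2 ≤ 3 * d ∧ ¬ (3 * d < 2 * Sig + ind) := by
  constructor <;> omega

/-- PROPOSITION 9.3 COUNT (codimension-2 subgroup pairs, `d₂ + d₃ = d − 2`).  The pinned piece / level
`N` of the third member (`d₁ ≤ dim N + 1`) has `A`-slice `s_N` with `2 dim N ≤ 2 s_N + ρ`,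
`ρ = d − 1 − a`, and inside `A` either Lemma 2.1 gives `s_N = 0` or Theorem 9 gives
`s_N ≤ 1 ∨ 2 s_N ≤ a + 2 − ind 𝔤` (`a' ≥ ind 𝔤 − 3`); with `a ≥ ind 𝔤 − 1` this yields
`2Σ ≤ 3d − ind 𝔤`: at most the threshold value, never strictly above it. -/
theorem soloLie_prop93_count (d ind a dimN sN d₁ : ℤ)
    (hρ : 2 * dimN ≤ 2 * sN + (d - 1 - a)) (hcase : sN ≤ 1 ∨ 2 * sN ≤ a + 2 - ind)
    (hind : ind ≤ a + 1) (hd₁ : d₁ ≤ dimN + 1) :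
    2 * (d - 2 + d₁) ≤ 3 * d - ind := by
  rcases hcase with h | h <;> omega

/-- COROLLARY 9.4(a) CENSUS (`GL₇(ℝ)`, `d = 49`): a two-subgroup template whose subgroup pair has
codimension `e + 1 ≥ 3` (`d₂ + d₃ = 48 − e`), subject to the pair bounds `d₁ + d_j ≤ 48`, reaches the
sub-3 range `Σ ≥ 71` only in the odd two-pair format `(25; 23, 23)`. -/
theorem soloLie_cor94_census (e d₁ d₂ d₃ : ℕ) (he : 2 ≤ e) (hU : d₂ + d₃ + e = 48)
    (h12 : d₁ + d₂ ≤ 48) (h13 : d₁ + d₃ ≤ 48) (hSig : 71 ≤ d₁ + d₂ + d₃) :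
    e = 2 ∧ d₁ = 25 ∧ d₂ = 23 ∧ d₃ = 23 := by
  omega

/-- COROLLARY 9.4(b) SLICES (`GL₇(ℝ)`, one subgroup member `H₂` of dimension 24, level `N ⊂ M₃` of
dimension 23, `M₁` of dimension 23): with `a = dim A = 2k ≥ 6` and `ρ = 48 − a`, the `A`-slices have
dimensions `≥ (23 − ρ/2, 24 − ρ/2, 23 − ρ/2)` and Lemma 2.1 in `A` caps the two pairs containing the
subgroup slice at `a − 1`; the slice dimensions are then exactly `(k − 1, k, k − 1)` — the two-pair
format of the even-dimensional group `A`. -/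
theorem soloLie_cor94_slices (k s₁ s₂ s₃ : ℕ) (hk : 3 ≤ k)
    (h1 : 23 ≤ s₁ + (24 - k)) (h2 : 24 ≤ s₂ + (24 - k)) (h3 : 23 ≤ s₃ + (24 - k))
    (hk24 : k ≤ 24) (hp12 : s₁ + s₂ ≤ 2 * k - 1) (hp23 : s₂ + s₃ ≤ 2 * k - 1) :
    s₁ = k - 1 ∧ s₂ = k ∧ s₃ = k - 1 := by
  omega

end Summit.MatrixMultiplication.MatrixMultiplication.Theorems
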